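import Literature.Analysis.OperatorTheory.StandardSubspace
import Literature.MathematicalPhysics.AQFT.CyclicSeparating
import HarnessLib

/-!
# The standard real subspace `𝒦 = closure(M_sa Ω)` of a von Neumann algebra with standard vector
# (Rieffel–van Daele, Proposition 4.1)

Let `M` be a von Neumann algebra on `H` and `Ω` cyclic and separating. Rieffel–van Daele
(*A bounded operator approach to Tomita–Takesaki theory*, Pacific J. Math. 69 (1977), §4):

> PROPOSITION 4.1. Let `𝒦` denote the closure of `M_s ω`. Then `𝒦` is a (closed) real subspace of
> `ℋ` such that `𝒦 ∩ i𝒦 = {0}` and `𝒦 + i𝒦` is dense in `ℋ`. Moreover `M'_s ω ⊆ i𝒦^⊥`.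

(proof: "`⟨xω, x'ω⟩ = ⟨x'xω, ω⟩ = ⟨x'ω, xω⟩` is real, so `Re ⟨xω, ix'ω⟩ = 0` … `M'ω ⊆ i𝒦^⊥ + 𝒦^⊥
⊆ (𝒦 ∩ i𝒦)^⊥`. Since `ω` is cyclic for `M'`, … `𝒦 ∩ i𝒦 = {0}`"), together with the facts used in
the proof of Lemma 4.9: "`Jω = ω`. This is because `ω ∈ 𝒦 ∩ i𝒦^⊥`, so that `Pω = ω` and `Qω = 0`, so
that `Rω = ω = TJω` and `Tω = ω`."

This file builds `𝒦` as a `Submodule ℝ H` (`tomitaK M Ω`, with its orthogonal projection) and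
proves Prop. 4.1 and these facts, so that the operators `R, T, J` of
`Literature.Analysis.OperatorTheory.StandardSubspace` apply to `(M, Ω)`.

## References
* M. A. Rieffel, A. van Daele, *A bounded operator approach to Tomita–Takesaki theory*, Pacific
  J. Math. 69 (1977) 187–221, Prop. 4.1, Lemma 4.9 (proof). [RieffelVandaele1977]
-/

noncomputable section

open Complex ContinuousLinearMap
open scoped InnerProductSpace ComplexConjugate

set_option synthInstance.maxHeartbeats 200000

namespace Literature.MathematicalPhysics.AQFT

open Literature.Analysis.OperatorTheory

attribute [local instance] Literature.Analysis.OperatorTheory.realIPS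

variable {H : Type*} [NormedAddCommGroup H] [InnerProductSpace ℂ H] [CompleteSpace H]

/-! ### The subspace `𝒦 = closure(M_sa Ω)` -/

/-- The real linear span of `M_sa Ω` (which equals `M_sa Ω`). [cite: RieffelVandaele1977, Prop. 4.1] -/
def saOrbit (M : VonNeumannAlgebra H) (Ω : H) : Submodule ℝ H :=
  Submodule.span ℝ {x : H | ∃ A ∈ M, IsSelfAdjoint A ∧ x = A Ω}

/-- **The real subspace `𝒦 = closure(M_sa Ω)`** of Rieffel–van Daele Prop. 4.1.
[cite: RieffelVandaele1977, Prop. 4.1] -/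
def tomitaK (M : VonNeumannAlgebra H) (Ω : H) : Submodule ℝ H := (saOrbit M Ω).topologicalClosure

variable (M : VonNeumannAlgebra H) (Ω : H)

/-- `𝒦` is closed. [cite: RieffelVandaele1977, Prop. 4.1] -/
theorem isClosed_tomitaK : IsClosed (tomitaK M Ω : Set H) := (saOrbit M Ω).isClosed_topologicalClosure

/-- `𝒦` is complete. [folklore] -/
instance instCompleteSpaceTomitaK : CompleteSpace (tomitaK M Ω) :=
  (isClosed_tomitaK M Ω).completeSpace_coe

/-- `𝒦` has an orthogonal projection. [folklore] -/
instance instHasOrthogonalProjectionTomitaK : (tomitaK M Ω).HasOrthogonalProjection :=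
  Submodule.HasOrthogonalProjection.ofCompleteSpace _

variable {M Ω}

/-- `A Ω ∈ 𝒦` for self-adjoint `A ∈ M`. [cite: RieffelVandaele1977, Prop. 4.1] -/
theorem apply_mem_tomitaK {A : H →L[ℂ] H} (hA : A ∈ M) (hsa : IsSelfAdjoint A) : A Ω ∈ tomitaK M Ω :=
  (saOrbit M Ω).le_topologicalClosure (Submodule.subset_span ⟨A, hA, hsa, rfl⟩)

/-- `Ω ∈ 𝒦`. [cite: RieffelVandaele1977, Lemma 4.9 (proof)] -/
theorem self_mem_tomitaK : Ω ∈ tomitaK M Ω := by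
  simpa using apply_mem_tomitaK (M := M) (Ω := Ω) (one_mem _) (IsSelfAdjoint.one _)

/-- The inner product `⟪A Ω, A' Ω⟫` is real for self-adjoint `A ∈ M`, `A' ∈ M'` (Rieffel–van Daele,
proof of Prop. 4.1: "`(xω, x'ω) = (x'xω, ω) = (x'ω, xω)`"). [cite: RieffelVandaele1977, Prop. 4.1 (proof)] -/
theorem inner_apply_apply_conj {A A' : H →L[ℂ] H} (hA : A ∈ M) (hsa : IsSelfAdjoint A)
    (hA' : A' ∈ M.commutant) (hsa' : IsSelfAdjoint A') :
    conj ⟪A Ω, A' Ω⟫_ℂ = ⟪A Ω, A' Ω⟫_ℂ := by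
  have hAs := ContinuousLinearMap.isSelfAdjoint_iff_isSymmetric.1 hsa
  have hA's := ContinuousLinearMap.isSelfAdjoint_iff_isSymmetric.1 hsa'
  rw [inner_conj_symm]
  -- `⟪A'Ω, AΩ⟫ = ⟪Ω, A' A Ω⟫ = ⟪Ω, A A' Ω⟫ = ⟪A Ω, A' Ω⟫`
  calc ⟪A' Ω, A Ω⟫_ℂ = ⟪Ω, A' (A Ω)⟫_ℂ := by simpa only [ContinuousLinearMap.coe_coe] using hA's Ω (A Ω)
    _ = ⟪Ω, A (A' Ω)⟫_ℂ := by rw [commutant_apply_comm hA hA']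
    _ = ⟪A Ω, A' Ω⟫_ℂ := by simpa only [ContinuousLinearMap.coe_coe] using (hAs Ω (A' Ω)).symm

/-- **`M'_sa Ω ⊆ (i𝒦)^⊥`** (Rieffel–van Daele Prop. 4.1: "`M'_s ω ⊆ i𝒦^⊥`"): `Re ⟪i k, A' Ω⟫ = 0` for
`k ∈ 𝒦`. [cite: RieffelVandaele1977, Prop. 4.1] -/
theorem apply_mem_mulI_orthogonal {A' : H →L[ℂ] H} (hA' : A' ∈ M.commutant) (hsa' : IsSelfAdjoint A') :
    A' Ω ∈ (mulI (tomitaK M Ω))ᗮ := by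
  rw [Submodule.mem_orthogonal]
  intro u hu
  obtain ⟨k, hk, rfl⟩ := mem_mulI.1 hu
  -- reduce to `k ∈ M_sa Ω` by density and continuity
  have hcl : ∀ k ∈ tomitaK M Ω, ⟪(I : ℂ) • k, A' Ω⟫_ℝ = 0 := by
    intro k hk
    have hc : Continuous fun k : H => ⟪(I : ℂ) • k, A' Ω⟫_ℝ := by fun_prop
    have hzero : ∀ k ∈ saOrbit M Ω, ⟪(I : ℂ) • k, A' Ω⟫_ℝ = 0 := by
      intro k hk
      refine Submodule.span_induction (p := fun k _ => ⟪(I : ℂ) • k, A' Ω⟫_ℝ = 0) ?_ (by simp) ?_ ?_ hk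
      · rintro _ ⟨A, hA, hsa, rfl⟩
        rw [real_inner_eq_re, inner_smul_left, Complex.conj_I]
        have hreal := inner_apply_apply_conj (Ω := Ω) hA hsa hA' hsa'
        have him : (⟪A Ω, A' Ω⟫_ℂ).im = 0 := by
          have := congrArg Complex.im hreal
          simp only [Complex.conj_im] at this
          linarith
        simp [him]
      · intro x y _ _ hx hy
        rw [smul_add, inner_add_left, hx, hy, add_zero]
      · intro r x _ hx
        rw [smul_comm, real_inner_smul_left, hx, mul_zero]
    exact (isClosed_eq hc continuous_const).closure_subset_iff.2 hzero hk |> fun h => by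
      simpa using (Set.mem_setOf.1 h)
  exact hcl k hk

/-- `Ω ⊥ i𝒦`. [cite: RieffelVandaele1977, Lemma 4.9 (proof)] -/
theorem self_mem_mulI_orthogonal : Ω ∈ (mulI (tomitaK M Ω))ᗮ := by
  simpa using apply_mem_mulI_orthogonal (M := M) (Ω := Ω) (one_mem _) (IsSelfAdjoint.one _)

/-- **`𝒦 + i𝒦` is dense** (`⊇ M Ω`, which is dense when `Ω` is cyclic).
[cite: RieffelVandaele1977, Prop. 4.1] -/
theorem dense_tomitaK_sup (hcyc : IsCyclicVector M Ω) :
    Dense ((tomitaK M Ω ⊔ mulI (tomitaK M Ω) : Submodule ℝ H) : Set H) := by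
  refine hcyc.mono ?_
  rintro _ ⟨A, rfl⟩
  -- `A Ω = (Re A) Ω + i (Im A) Ω` with `Re A = (A + A*)/2`, `Im A = (A - A*)/(2i)` self-adjoint in `M`
  set A₁ : H →L[ℂ] H := (2⁻¹ : ℂ) • ((A : H →L[ℂ] H) + star (A : H →L[ℂ] H)) with hA₁
  set A₂ : H →L[ℂ] H := (-(2⁻¹ : ℂ) * I) • ((A : H →L[ℂ] H) - star (A : H →L[ℂ] H)) with hA₂
  have hA₁M : A₁ ∈ M := M.toStarSubalgebra.smul_mem (add_mem A.2 (star_mem A.2)) _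
  have hA₂M : A₂ ∈ M := M.toStarSubalgebra.smul_mem (sub_mem A.2 (star_mem A.2)) _
  have hA₁sa : IsSelfAdjoint A₁ := by
    rw [hA₁, IsSelfAdjoint, star_smul, star_add, star_star, add_comm]
    congr 1
    simp
  have hA₂sa : IsSelfAdjoint A₂ := by
    rw [hA₂, IsSelfAdjoint, star_smul, star_sub, star_star]
    rw [show star (-(2⁻¹ : ℂ) * I) = (2⁻¹ : ℂ) * I by simp, ← neg_sub (A : H →L[ℂ] H),
      smul_neg, ← neg_smul]
    congr 1
    ring
  have hdecomp : (A : H →L[ℂ] H) Ω = A₁ Ω + (I : ℂ) • A₂ Ω := by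
    rw [hA₁, hA₂]
    simp only [smul_apply, add_apply, sub_apply, smul_smul]
    rw [show I * (-(2⁻¹ : ℂ) * I) = 2⁻¹ by rw [mul_comm, mul_assoc, I_mul_I]; ring]
    rw [smul_add, smul_sub, add_add_sub_cancel, ← add_smul]
    norm_num
  change (A : H →L[ℂ] H) Ω ∈ _
  rw [hdecomp]
  exact Submodule.add_mem_sup (apply_mem_tomitaK hA₁M hA₁sa)
    (I_smul_mem_mulI (apply_mem_tomitaK hA₂M hA₂sa))

/-- **`𝒦 ∩ i𝒦 = 0`** when `Ω` is separating for `M` (Rieffel–van Daele Prop. 4.1: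
`M'Ω ⊆ i𝒦^⊥ + 𝒦^⊥ ⊆ (𝒦 ∩ i𝒦)^⊥` and `Ω` is cyclic for `M'`). [cite: RieffelVandaele1977, Prop. 4.1] -/
theorem tomitaK_inf_mulI (hsep : IsSeparatingVector M Ω) :
    ∀ x, x ∈ tomitaK M Ω → x ∈ mulI (tomitaK M Ω) → x = 0 := by
  intro x hxK hxI
  set K := tomitaK M Ω
  -- `M' Ω ⊆ (K ⊓ iK)ᗮ`
  have hcyc' : IsCyclicVector M.commutant Ω := hsep.isCyclicVector_commutant
  have horth : ∀ A' ∈ M.commutant, ⟪x, A' Ω⟫_ℝ = 0 := by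
    intro A' hA'
    -- decompose `A' = A'₁ + i A'₂`
    set B₁ : H →L[ℂ] H := (2⁻¹ : ℂ) • (A' + star A') with hB₁
    set B₂ : H →L[ℂ] H := (-(2⁻¹ : ℂ) * I) • (A' - star A') with hB₂
    have hB₁M : B₁ ∈ M.commutant := M.commutant.toStarSubalgebra.smul_mem (add_mem hA' (star_mem hA')) _
    have hB₂M : B₂ ∈ M.commutant := M.commutant.toStarSubalgebra.smul_mem (sub_mem hA' (star_mem hA')) _
    have hB₁sa : IsSelfAdjoint B₁ := by
      rw [hB₁, IsSelfAdjoint, star_smul, star_add, star_star, add_comm]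
      congr 1
      simp
    have hB₂sa : IsSelfAdjoint B₂ := by
      rw [hB₂, IsSelfAdjoint, star_smul, star_sub, star_star]
      rw [show star (-(2⁻¹ : ℂ) * I) = (2⁻¹ : ℂ) * I by simp, ← neg_sub A',
        smul_neg, ← neg_smul]
      congr 1
      ring
    have hdecomp : A' Ω = B₁ Ω + (I : ℂ) • B₂ Ω := by
      rw [hB₁, hB₂]
      simp only [smul_apply, add_apply, sub_apply, smul_smul]
      rw [show I * (-(2⁻¹ : ℂ) * I) = 2⁻¹ by rw [mul_comm, mul_assoc, I_mul_I]; ring]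
      rw [smul_add, smul_sub, add_add_sub_cancel, ← add_smul]
      norm_num
    -- `B₁ Ω ⊥ x` since `x ∈ iK` and `B₁ Ω ∈ (iK)ᗮ`; `i B₂ Ω ⊥ x` since `x ∈ K`, i.e. `-i x ∈ iK`... use `B₂ Ω ∈ (iK)ᗮ`
    have h1 : ⟪x, B₁ Ω⟫_ℝ = 0 := by
      have := apply_mem_mulI_orthogonal (Ω := Ω) hB₁M hB₁sa
      rw [Submodule.mem_orthogonal] at this
      exact this x hxI
    have h2 : ⟪x, (I : ℂ) • B₂ Ω⟫_ℝ = 0 := by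
      have := apply_mem_mulI_orthogonal (Ω := Ω) hB₂M hB₂sa
      rw [Submodule.mem_orthogonal] at this
      have h := this ((I : ℂ) • x) (I_smul_mem_mulI hxK)
      rw [real_inner_eq_re] at h ⊢
      rw [inner_smul_right]
      rw [inner_smul_left, Complex.conj_I] at h
      have : I * ⟪x, B₂ Ω⟫_ℂ = -(-I * ⟪x, B₂ Ω⟫_ℂ) := by ring
      rw [this, Complex.neg_re, h, neg_zero]
    rw [hdecomp, inner_add_right, h1, h2, add_zero]
  -- density of `M' Ω`
  have hc : Continuous fun v : H => ⟪x, v⟫_ℝ := by fun_prop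
  have hall : ∀ v : H, ⟪x, v⟫_ℝ = 0 := by
    have hsub : Set.range (fun A : M.commutant => (A : H →L[ℂ] H) Ω) ⊆ {v | ⟪x, v⟫_ℝ = 0} := by
      rintro _ ⟨A', rfl⟩
      exact horth A' A'.2
    have hcl : closure (Set.range (fun A : M.commutant => (A : H →L[ℂ] H) Ω)) ⊆ {v | ⟪x, v⟫_ℝ = 0} :=
      (isClosed_eq hc continuous_const).closure_subset_iff.2 hsub
    rw [hcyc'.closure_eq] at hcl
    exact fun v => hcl (Set.mem_univ v)
  have := hall x
  rwa [real_inner_self_eq_norm_sq, sq_eq_zero_iff, norm_eq_zero] at this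

/-- **`P Ω = Ω`**. [cite: RieffelVandaele1977, Lemma 4.9 (proof)] -/
theorem starProjection_tomitaK_self : (tomitaK M Ω).starProjection Ω = Ω :=
  Submodule.starProjection_eq_self_iff.2 self_mem_tomitaK

/-- **`Q Ω = 0`**. [cite: RieffelVandaele1977, Lemma 4.9 (proof)] -/
theorem starProjection_mulI_tomitaK_self : (mulI (tomitaK M Ω)).starProjection Ω = 0 :=
  (Submodule.starProjection_apply_eq_zero_iff _).2 self_mem_mulI_orthogonal

/-- **`R Ω = Ω`**. [cite: RieffelVandaele1977, Lemma 4.9 (proof)] -/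
theorem modR_tomitaK_self : modR (tomitaK M Ω) Ω = Ω := by
  rw [modR_apply, starProjection_tomitaK_self, starProjection_mulI_tomitaK_self, add_zero]

/-- **`(P − Q) Ω = Ω`**. [cite: RieffelVandaele1977, Lemma 4.9 (proof)] -/
theorem modB_tomitaK_self : modB (tomitaK M Ω) Ω = Ω := by
  rw [modB_apply, starProjection_tomitaK_self, starProjection_mulI_tomitaK_self, sub_zero]

/-- `Q (A' Ω) = 0` for self-adjoint `A' ∈ M'`. [cite: RieffelVandaele1977, Prop. 4.1 and Cor. 4.4 (proof)] -/
theorem starProjection_mulI_apply_commutant {A' : H →L[ℂ] H} (hA' : A' ∈ M.commutant)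
    (hsa' : IsSelfAdjoint A') : (mulI (tomitaK M Ω)).starProjection (A' Ω) = 0 :=
  (Submodule.starProjection_apply_eq_zero_iff _).2 (apply_mem_mulI_orthogonal hA' hsa')

/-- `P (A Ω) = A Ω` for self-adjoint `A ∈ M`. [cite: RieffelVandaele1977, Prop. 4.1] -/
theorem starProjection_apply_mem {A : H →L[ℂ] H} (hA : A ∈ M) (hsa : IsSelfAdjoint A) :
    (tomitaK M Ω).starProjection (A Ω) = A Ω :=
  Submodule.starProjection_eq_self_iff.2 (apply_mem_tomitaK hA hsa)

/-- **`T² Ω = Ω`**, from `R Ω = Ω` and `(P − Q) Ω = Ω`. [cite: RieffelVandaele1977, Lemma 4.9 (proof)] -/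
theorem modTsq_tomitaK_self : modTsq (tomitaK M Ω) Ω = Ω := by
  rw [modTsq_apply, modB_tomitaK_self, modB_tomitaK_self]

/-- **`T Ω = Ω`** (Rieffel–van Daele, proof of Lemma 4.9: "`Rω = ω = TJω` and `Tω = ω`"): `T` is a
nonnegative operator with `T² Ω = Ω`. [cite: RieffelVandaele1977, Lemma 4.9 (proof)] -/
theorem modT_tomitaK_self : modT (tomitaK M Ω) Ω = Ω := by
  set K := tomitaK M Ω
  -- `(T + 1)(T - 1) Ω = (T² - 1) Ω = 0` and `T + 1` is injective (`T ≥ 0`)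
  have hsq : (modT K * modT K) Ω = Ω := by rw [modT_mul_modT]; exact modTsq_tomitaK_self
  have h1 : (modT K + 1) ((modT K - 1) Ω) = 0 := by
    rw [← mul_apply_eq_comp, show (modT K + 1) * (modT K - 1) = modT K * modT K - 1 by noncomm_ring,
      sub_apply, hsq, one_apply_eq_self, sub_self]
  -- injectivity of `T + 1`: `⟪(T+1) v, v⟫ ≥ ‖v‖²`
  have hinj : ∀ v : H, (modT K + 1) v = 0 → v = 0 := by
    intro v hv
    have hpos := (ContinuousLinearMap.nonneg_iff_isPositive _).1 (modT_nonneg K)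
    have h := hpos.2 v
    rw [ContinuousLinearMap.reApplyInnerSelf_apply] at h
    have : ⟪(modT K + 1) v, v⟫_ℝ = 0 := by rw [hv, inner_zero_left]
    rw [add_apply, one_apply_eq_self, inner_add_left, real_inner_self_eq_norm_sq, real_inner_eq_re] at this
    rw [RCLike.re_to_complex] at h
    have hv2 : ‖v‖ ^ 2 = 0 := by nlinarith [sq_nonneg ‖v‖]
    exact norm_eq_zero.1 (pow_eq_zero_iff two_ne_zero |>.1 hv2)
  have := hinj _ h1
  rw [sub_apply, one_apply_eq_self, sub_eq_zero] at this
  exact this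

end Literature.MathematicalPhysics.AQFT
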